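import Literature.MathematicalPhysics.QuantumFieldTheory.Balaban1983to89.T3BareTailProfile
import HarnessLib

/-!
# `Balaban1983to89.T3AveragedTailProfile` — rung R3, crux K2 `HistoryTail`: the block-AVERAGED heights of `HeightTailAt` follow from
# a PER-PLAQUETTE, PER-HEIGHT large-field tail by the union bound and «Gaussian beats exponential» (the bookkeeping half of K2, PROVED)

Cell `ym3-torus` (HUMAN RULING D-0037, YM ladder rung R3), seat `ym3-torus-p2` gen 7; the registered stub `stub_tailOfPerPlaquette` of
`stmt-QuantumFields-18916`'s BC3 birth v3 (route owner plan g10, `HOME/route-R3/ym/plan-g10/HistoryTail_birth_v3.lean`).  v3 splits the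
averaged heights `AveragedTailAt F γ b₀ p₀` (`T3BareTailProfile`, p411095: a summable profile `q` with
`Gibbs_K{U : ¬PlaqSmall θ(K−j) (Ū^{j})} ≤ q(K−j)`, `1 ≤ j ≤ K`) into

* the RENORMALISATION-GROUP content (`stub_perPlaquetteOfAlpha`, XL, not here): a PER-PLAQUETTE schema — `C ≥ 0`, `A : ℕ`, `c > 0` with
  `Gibbs_K{U : θ(K−j) ≤ |Ū^{j}(∂p) − 1|} ≤ C·β_{K−j}^A·exp(−c·p(g_{K−j})²)` for every `K`, every height `1 ≤ j ≤ K` and every plaquette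
  `p` of `T^{(j)}` — the currency in which print delivers large-field smallness ([Balaban1985UV3] (71) p.273: `exp(−¼p(g_j)²)` per large
  plaquette; `β_i = (γL^{−i})⁻¹`, `g_i = √(γL^{−i})`, `p = B10.pFun b₀ p₀`);
* the BOOKKEEPING, proved here: **`averagedTailAt_of_perPlaquette`** — for `0 < γ ≤ 1`, `0 < b₀`, `1 ≤ p₀` the per-plaquette schema
  implies `AveragedTailAt F γ b₀ p₀` with the geometric profile `q(i) = A'·2^{−i}`: union bound over the `≤ 9·(2L^{m+K−j})³` plaquettes
  of height `j` (`T3CruxEstimates.real_not_plaqSmall_comp_le_sum` pulled back along the `j`-fold averaging), `β_i^A = γ^{−A}L^{iA}`,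
  `p(g_i) ≥ ½b₀·i·log L`, hence `L^{(3+A)i}·e^{−(c b₀² log²L/4) i²} ≤ e^{b²/4a}·2^{−i}` (completing the square) — VERBATIM the
  technique of `T3BareTailProfile.bareTailAt` one level up; and the packaged consequences `heightTailAt_of_perPlaquette`,
  `historyTailAt_of_perPlaquette` (every `m ≥ 1`).

WHAT THIS IS NOT: not the per-plaquette schema itself (the located, unprinted content of K2), no (α), no continuum statement.
-/

noncomputable section

open MeasureTheory Filter Topology
open Literature.MathematicalPhysics.QuantumFieldTheory.Balaban1983to89.T3ContinuumYM3Torus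
open Literature.MathematicalPhysics.QuantumFieldTheory.Balaban1983to89.T3UnitScaleTilt
open Literature.MathematicalPhysics.QuantumFieldTheory.Balaban1983to89.T3UnitLawDensityEML
open Literature.MathematicalPhysics.QuantumFieldTheory.Balaban1983to89.T3CruxEstimates
open Literature.MathematicalPhysics.QuantumFieldTheory.Balaban1983to89.T3BareTailProfile

namespace Literature.MathematicalPhysics.QuantumFieldTheory.Balaban1983to89.T3AveragedTailProfile

section Profile

/-- Completing the square: `b t − a t² ≤ b²/(4a)` for `a > 0`. [folklore] -/
private theorem quadratic_le {a : ℝ} (ha : 0 < a) (b t : ℝ) : b * t - a * t ^ 2 ≤ b ^ 2 / (4 * a) := by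
  rw [le_div_iff₀ (by positivity)]
  nlinarith [sq_nonneg (2 * a * t - b)]

/-- The height-`j` lattice of the `K`-th approximation has `2L^{m+K−j}` sites per direction (`j ≤ K`). [cite: Balaban1985UV3, (1)-(3) p.256] -/
private theorem sitesPerDir_eq (F : T3Family) {K j : ℕ} (hj : j ≤ K) :
    (F.P K).sitesPerDir j = 2 * F.L ^ (F.m + (K - j)) := by
  show 2 * F.L ^ (F.m + K - j) = 2 * F.L ^ (F.m + (K - j))
  rw [show F.m + K - j = F.m + (K - j) by omega]

/-- The inverse coupling at distance `i` from the unit scale: `β_i = (γ L^{−i})⁻¹`. [cite: Balaban1985UV3, (1)-(3) p.256] -/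
private theorem scheme_β_eq (F : T3Family) (γ : ℝ) (i : ℕ) : (F.scheme ℰp γ).β i = (γ * ((F.L : ℝ)⁻¹) ^ i)⁻¹ := rfl

/-- `#plaquettes of T^{(j)} ≤ 9·(sites per direction)³` (crude: `d² = 9` plane labels per site). [cite: Balaban1985UV3, (1)-(3) p.256] -/
private theorem card_plaq_le (F : T3Family) (K j : ℕ) :
    (Fintype.card (Plaq (F.P K) j) : ℝ) ≤ 9 * ((F.P K).sitesPerDir j : ℝ) ^ 3 := by
  have h1 : Fintype.card (Plaq (F.P K) j) = Fintype.card (Plaquette 3 ((F.P K).sitesPerDir j)) :=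
    Fintype.card_congr (plaqEquiv (P := F.P K) j)
  have h2 : Fintype.card (Plaquette 3 ((F.P K).sitesPerDir j)) ≤ ((F.P K).sitesPerDir j) ^ 3 * 3 ^ 2 := by
    rw [Fintype.card_prod, Fintype.card_fun, ZMod.card, Fintype.card_fin]
    gcongr
    calc Fintype.card {p : Fin 3 × Fin 3 // p.1 < p.2} ≤ Fintype.card (Fin 3 × Fin 3) := Fintype.card_subtype_le _
      _ = 3 ^ 2 := by rw [Fintype.card_prod, Fintype.card_fin]; norm_num
  rw [h1]
  calc (Fintype.card (Plaquette 3 ((F.P K).sitesPerDir j)) : ℝ) ≤ (((F.P K).sitesPerDir j) ^ 3 * 3 ^ 2 : ℕ) := by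
        exact_mod_cast h2
    _ = 9 * ((F.P K).sitesPerDir j : ℝ) ^ 3 := by push_cast; ring

/-- **THE PER-HEIGHT ARITHMETIC** (`0 < γ ≤ 1`, `0 < b₀`, `1 ≤ p₀`, `C ≥ 0`, `c > 0`): at distance `i` from the unit scale,
`9·(8L^{3m}(L^i)³) · C β_i^A e^{−c p(g_i)²} ≤ A'·2^{−i}` with the explicit constant
`A' = 72·C·L^{3m}·γ^{−A}·exp(b²/4a)`, `a = c b₀² log²L/4`, `b = (3+A) log L + log 2` — `β_i^A = γ^{−A}L^{iA}`,
`p(g_i) ≥ ½ b₀ i log L`, completing the square. [cite: Balaban1985UV3, (7) p.257 and (71) p.273] -/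
theorem perHeight_bound (F : T3Family) {γ b₀ p₀ : ℝ} (hγ : 0 < γ) (hγ1 : γ ≤ 1) (hb₀ : 0 < b₀) (hp₀ : 1 ≤ p₀)
    {C : ℝ} (hC : 0 ≤ C) (A : ℕ) {c : ℝ} (hc : 0 < c) (i : ℕ) :
    (9 * (8 * (F.L : ℝ) ^ (3 * F.m) * ((F.L : ℝ) ^ i) ^ 3)) *
        (C * (F.scheme ℰp γ).β i ^ A *
          Real.exp (-(c * B10.pFun b₀ p₀ (Real.sqrt (γ * ((F.L : ℝ)⁻¹) ^ i)) ^ 2))) ≤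
      (72 * C * (F.L : ℝ) ^ (3 * F.m) * γ⁻¹ ^ A *
          Real.exp ((((3 : ℝ) + A) * Real.log F.L + Real.log 2) ^ 2 / (4 * (c * b₀ ^ 2 * Real.log F.L ^ 2 / 4)))) *
        ((1 : ℝ) / 2) ^ i := by
  -- constants
  have hL1 : (1 : ℝ) < F.L := by exact_mod_cast F.hL.2
  have hL0 : (0 : ℝ) < F.L := one_pos.trans hL1
  set ℓ : ℝ := Real.log F.L with hℓ
  have hℓ0 : 0 < ℓ := Real.log_pos hL1
  have hlogγ : Real.log γ ≤ 0 := Real.log_nonpos hγ.le hγ1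
  set a : ℝ := c * b₀ ^ 2 * ℓ ^ 2 / 4 with ha
  have ha0 : 0 < a := by positivity
  set b : ℝ := (3 + A) * ℓ + Real.log 2 with hb
  -- the coupling at distance `i`
  set x : ℝ := γ * ((F.L : ℝ)⁻¹) ^ i with hx
  have hLK : (1 : ℝ) ≤ (F.L : ℝ) ^ i := one_le_pow₀ hL1.le
  have hLK0 : (0 : ℝ) < (F.L : ℝ) ^ i := pow_pos hL0 i
  have hinvK : ((F.L : ℝ)⁻¹) ^ i = ((F.L : ℝ) ^ i)⁻¹ := by rw [inv_pow]
  have hx0 : 0 < x := by rw [hx, hinvK]; positivity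
  have hxinv : x⁻¹ = γ⁻¹ * (F.L : ℝ) ^ i := by rw [hx, hinvK, mul_inv, inv_inv]
  set g : ℝ := Real.sqrt x with hg
  have hg0 : 0 < g := Real.sqrt_pos.mpr hx0
  have hlogg : Real.log g⁻¹ = (i * ℓ - Real.log γ) / 2 := by
    rw [Real.log_inv, hg, Real.log_sqrt hx0.le, hx, Real.log_mul hγ.ne' (pow_ne_zero _ (inv_ne_zero hL0.ne')),
      Real.log_pow, Real.log_inv]
    ring
  set u : ℝ := 1 + Real.log g⁻¹ with hu
  have hu1 : 1 ≤ u := by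
    rw [hu, hlogg]
    have : 0 ≤ (i : ℝ) * ℓ := by positivity
    linarith
  have huK : (i : ℝ) * ℓ / 2 ≤ u := by
    rw [hu, hlogg]; linarith
  -- `p(g_i) ≥ ½ b₀ i log L ≥ 0`
  have hpF : B10.pFun b₀ p₀ g = b₀ * u ^ p₀ := rfl
  have hup : u ≤ u ^ p₀ := Real.self_le_rpow_of_one_le hu1 hp₀
  have hpF_ge : b₀ * ((i : ℝ) * ℓ / 2) ≤ B10.pFun b₀ p₀ g := by
    rw [hpF]
    calc b₀ * ((i : ℝ) * ℓ / 2) ≤ b₀ * u := by gcongr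
      _ ≤ b₀ * u ^ p₀ := by gcongr
  -- the Gaussian factor
  have hexp : Real.exp (-(c * B10.pFun b₀ p₀ g ^ 2)) ≤ Real.exp (-(a * (i : ℝ) ^ 2)) := by
    refine Real.exp_le_exp.mpr ?_
    have hsq : (b₀ * ((i : ℝ) * ℓ / 2)) ^ 2 ≤ B10.pFun b₀ p₀ g ^ 2 :=
      pow_le_pow_left₀ (by positivity) hpF_ge 2
    have : a * (i : ℝ) ^ 2 = c * (b₀ * ((i : ℝ) * ℓ / 2)) ^ 2 := by rw [ha]; ring
    rw [this]
    nlinarith [mul_le_mul_of_nonneg_left hsq hc.le]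
  -- the inverse coupling factor `β_i^A = γ^{−A} (L^i)^A`
  have hβA : (F.scheme ℰp γ).β i ^ A = γ⁻¹ ^ A * ((F.L : ℝ) ^ i) ^ A := by
    rw [scheme_β_eq, ← hx, hxinv, mul_pow]
  -- `L^{(3+A)i} e^{−a i²} ≤ e^{b²/4a} 2^{−i}`
  have hLpow : ((F.L : ℝ) ^ i) ^ 3 * ((F.L : ℝ) ^ i) ^ A = Real.exp ((3 + A) * ((i : ℝ) * ℓ)) := by
    rw [← pow_add, ← pow_mul, hℓ, show ((3 : ℝ) + A) * ((i : ℝ) * Real.log F.L) = ((i * (3 + A) : ℕ) : ℝ) * Real.log F.L by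
      push_cast; ring, Real.exp_nat_mul, Real.exp_log hL0]
  have hhalf : ((1 : ℝ) / 2) ^ i = Real.exp (-((i : ℝ) * Real.log 2)) := by
    rw [Real.exp_neg, Real.exp_nat_mul, Real.exp_log two_pos, one_div, inv_pow]
  have hgauss : ((F.L : ℝ) ^ i) ^ 3 * ((F.L : ℝ) ^ i) ^ A * Real.exp (-(a * (i : ℝ) ^ 2)) ≤
      Real.exp (b ^ 2 / (4 * a)) * ((1 : ℝ) / 2) ^ i := by
    rw [hLpow, hhalf, ← Real.exp_add, ← Real.exp_add]
    refine Real.exp_le_exp.mpr ?_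
    have hq := quadratic_le ha0 b (i : ℝ)
    rw [hb] at hq ⊢
    nlinarith
  -- assemble
  rw [hβA]
  calc (9 * (8 * (F.L : ℝ) ^ (3 * F.m) * ((F.L : ℝ) ^ i) ^ 3)) *
        (C * (γ⁻¹ ^ A * ((F.L : ℝ) ^ i) ^ A) * Real.exp (-(c * B10.pFun b₀ p₀ g ^ 2)))
      ≤ (9 * (8 * (F.L : ℝ) ^ (3 * F.m) * ((F.L : ℝ) ^ i) ^ 3)) *
          (C * (γ⁻¹ ^ A * ((F.L : ℝ) ^ i) ^ A) * Real.exp (-(a * (i : ℝ) ^ 2))) := by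
        gcongr
    _ = (72 * C * (F.L : ℝ) ^ (3 * F.m) * γ⁻¹ ^ A) *
          (((F.L : ℝ) ^ i) ^ 3 * ((F.L : ℝ) ^ i) ^ A * Real.exp (-(a * (i : ℝ) ^ 2))) := by ring
    _ ≤ (72 * C * (F.L : ℝ) ^ (3 * F.m) * γ⁻¹ ^ A) * (Real.exp (b ^ 2 / (4 * a)) * ((1 : ℝ) / 2) ^ i) := by
        gcongr
    _ = (72 * C * (F.L : ℝ) ^ (3 * F.m) * γ⁻¹ ^ A * Real.exp (b ^ 2 / (4 * a))) * ((1 : ℝ) / 2) ^ i := by ring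

/-- **THE AVERAGED HEIGHTS OF K2 FROM A PER-PLAQUETTE TAIL** (`0 < γ ≤ 1`, `0 < b₀`, `1 ≤ p₀`): if for some `C ≥ 0`, `A : ℕ`,
`c > 0` every block-averaged plaquette at every height `1 ≤ j ≤ K` of every approximation `K` has Gibbs tail
`Gibbs_K{θ(K−j) ≤ |Ū^{j}(∂p) − 1|} ≤ C·β_{K−j}^A·e^{−c·p(g_{K−j})²}`, then `AveragedTailAt F γ b₀ p₀` holds with the geometric profile
`q(i) = A'·2^{−i}`: union bound over the `≤ 9·(2L^{m+K−j})³` plaquettes of height `j` and `perHeight_bound`.  The registered stub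
`stub_tailOfPerPlaquette` of the K2 line (birth v3). [cite: Balaban1985UV3, (7) p.257 and (71) p.273] -/
theorem averagedTailAt_of_perPlaquette (F : T3Family) {γ b₀ p₀ : ℝ} (hγ : 0 < γ) (hγ1 : γ ≤ 1) (hb₀ : 0 < b₀)
    (hp₀ : 1 ≤ p₀)
    (h : ∃ (C : ℝ) (A : ℕ) (c : ℝ), 0 ≤ C ∧ 0 < c ∧
      ∀ (K j : ℕ), 1 ≤ j → j ≤ K → ∀ p : Plaq (F.P K) j,
        (gibbsK F ℰp γ K).real
            {U | θBal F.L γ b₀ p₀ (K - j) ≤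
              GaugeGroup.dist1 (GaugeField.plaqHol
                (Averaging.iter (fun i => BlockAveraging.blockAvg (P := F.P K) (j := i) ℰp) j U) p)} ≤
          C * (F.scheme ℰp γ).β (K - j) ^ A *
            Real.exp (-(c * B10.pFun b₀ p₀ (Real.sqrt (γ * ((F.L : ℝ)⁻¹) ^ (K - j))) ^ 2))) :
    AveragedTailAt F γ b₀ p₀ := by
  obtain ⟨C, A, c, hC, hc, hbound⟩ := h
  have hL1 : (1 : ℝ) < F.L := by exact_mod_cast F.hL.2
  have hL0 : (0 : ℝ) < F.L := one_pos.trans hL1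
  -- the explicit constant of `perHeight_bound`
  obtain ⟨A', hA'def⟩ : ∃ A' : ℝ, A' = 72 * C * (F.L : ℝ) ^ (3 * F.m) * γ⁻¹ ^ A *
      Real.exp ((((3 : ℝ) + A) * Real.log F.L + Real.log 2) ^ 2 / (4 * (c * b₀ ^ 2 * Real.log F.L ^ 2 / 4))) := ⟨_, rfl⟩
  have hA'0 : 0 ≤ A' := by rw [hA'def]; positivity
  -- the profile
  refine ⟨fun i => A' * (1 / 2 : ℝ) ^ i, fun i => by positivity, ?_, ?_, fun K j hj1 hjK => ?_⟩
  · exact (summable_geometric_of_lt_one (by norm_num) (by norm_num)).mul_left A'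
  · have heq : (fun n => ∑' t, A' * (1 / 2 : ℝ) ^ (t + n)) = fun n => (2 * A') * (1 / 2 : ℝ) ^ n := by
      funext n
      have h1 : (fun t => A' * (1 / 2 : ℝ) ^ (t + n)) = fun t => (A' * (1 / 2 : ℝ) ^ n) * (1 / 2 : ℝ) ^ t := by
        funext t; rw [pow_add]; ring
      rw [h1, tsum_mul_left, tsum_geometric_two]; ring
    rw [heq]
    exact (summable_geometric_of_lt_one (by norm_num) (by norm_num)).mul_left (2 * A')
  -- the union bound over the plaquettes of height `j`, pulled back along the `j`-fold averaging
  haveI := isProbabilityMeasure_gibbsK F ℰp hγ.le K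
  have hunion := real_not_plaqSmall_comp_le_sum (gibbsK F ℰp γ K)
    (fun U => Averaging.iter (fun i => BlockAveraging.blockAvg (P := F.P K) (j := i) ℰp) j U) (θBal F.L γ b₀ p₀ (K - j))
  refine hunion.trans ?_
  refine (Finset.sum_le_sum fun p _ => hbound K j hj1 hjK p).trans ?_
  rw [Finset.sum_const, Finset.card_univ, nsmul_eq_mul]
  -- the number of plaquettes of height `j`
  have hM : ((F.P K).sitesPerDir j : ℝ) ^ 3 = 8 * (F.L : ℝ) ^ (3 * F.m) * ((F.L : ℝ) ^ (K - j)) ^ 3 := by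
    rw [sitesPerDir_eq F hjK]; push_cast; ring
  have hcard : (Fintype.card (Plaq (F.P K) j) : ℝ) ≤ 9 * (8 * (F.L : ℝ) ^ (3 * F.m) * ((F.L : ℝ) ^ (K - j)) ^ 3) := by
    rw [← hM]; exact card_plaq_le F K j
  have hnonneg : 0 ≤ C * (F.scheme ℰp γ).β (K - j) ^ A *
      Real.exp (-(c * B10.pFun b₀ p₀ (Real.sqrt (γ * ((F.L : ℝ)⁻¹) ^ (K - j))) ^ 2)) :=
    mul_nonneg (mul_nonneg hC (pow_nonneg (F.scheme_β_nonneg ℰp hγ.le (K - j)) A)) (Real.exp_nonneg _)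
  refine (mul_le_mul_of_nonneg_right hcard hnonneg).trans ?_
  rw [hA'def]
  exact perHeight_bound F hγ hγ1 hb₀ hp₀ hC A hc (K - j)

/-- **K2's ESTIMATE FROM A PER-PLAQUETTE TAIL**: under the same hypotheses `HeightTailAt F γ b₀ p₀` (the bare height is the landed
`T3BareTailProfile.bareTailAt`). [cite: Balaban1985UV3, (71) p.273] -/
theorem heightTailAt_of_perPlaquette (F : T3Family) {γ b₀ p₀ : ℝ} (hγ : 0 < γ) (hγ1 : γ ≤ 1) (hb₀ : 0 < b₀) (hp₀ : 1 ≤ p₀)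
    (h : ∃ (C : ℝ) (A : ℕ) (c : ℝ), 0 ≤ C ∧ 0 < c ∧
      ∀ (K j : ℕ), 1 ≤ j → j ≤ K → ∀ p : Plaq (F.P K) j,
        (gibbsK F ℰp γ K).real
            {U | θBal F.L γ b₀ p₀ (K - j) ≤
              GaugeGroup.dist1 (GaugeField.plaqHol
                (Averaging.iter (fun i => BlockAveraging.blockAvg (P := F.P K) (j := i) ℰp) j U) p)} ≤
          C * (F.scheme ℰp γ).β (K - j) ^ A *
            Real.exp (-(c * B10.pFun b₀ p₀ (Real.sqrt (γ * ((F.L : ℝ)⁻¹) ^ (K - j))) ^ 2))) :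
    HeightTailAt F γ b₀ p₀ :=
  (heightTailAt_iff_averagedTailAt F hγ hγ1 hb₀ hp₀).mpr (averagedTailAt_of_perPlaquette F hγ hγ1 hb₀ hp₀ h)

/-- **… AND THE ROUTE'S K2 BODY**: `HistoryTailAt F γ b₀ p₀ m` for every `m ≥ 1`. [cite: Balaban1985UV3, (71) p.273] -/
theorem historyTailAt_of_perPlaquette (F : T3Family) {γ b₀ p₀ : ℝ} (hγ : 0 < γ) (hγ1 : γ ≤ 1) (hb₀ : 0 < b₀) (hp₀ : 1 ≤ p₀)
    {m : ℕ} (hm : 0 < m)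
    (h : ∃ (C : ℝ) (A : ℕ) (c : ℝ), 0 ≤ C ∧ 0 < c ∧
      ∀ (K j : ℕ), 1 ≤ j → j ≤ K → ∀ p : Plaq (F.P K) j,
        (gibbsK F ℰp γ K).real
            {U | θBal F.L γ b₀ p₀ (K - j) ≤
              GaugeGroup.dist1 (GaugeField.plaqHol
                (Averaging.iter (fun i => BlockAveraging.blockAvg (P := F.P K) (j := i) ℰp) j U) p)} ≤
          C * (F.scheme ℰp γ).β (K - j) ^ A *
            Real.exp (-(c * B10.pFun b₀ p₀ (Real.sqrt (γ * ((F.L : ℝ)⁻¹) ^ (K - j))) ^ 2))) :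
    HistoryTailAt F γ b₀ p₀ m :=
  historyTailAt_of_averagedTailAt F hγ hγ1 hb₀ hp₀ hm (averagedTailAt_of_perPlaquette F hγ hγ1 hb₀ hp₀ h)

end Profile

/-! ## §2 The same bookkeeping with the hypotheses demanded ONLY ON THE HISTORY WEDGE `K ≤ m·(K − j + 1)`

The consumer of `HistoryTailAt F γ b₀ p₀ m` reads only the heights `j ≤ K' − ⌊K/m⌋` of the runs `K' ∈ {K, K+1}`, all of which satisfy the
wedge guard `K' ≤ m·(K' − j + 1)` (`T3HistoryTailReduction.historyTailAt_of_heightTailOnWedge`; route `HistoryWedge`, critic ruling idea-crit-5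
#105: the guard is a standing free hypothesis of every per-height / per-plaquette lever).  Here the two packaged consequences: an averaged-height
profile on the wedge (the bare height is `T3BareTailProfile.bareTailAt`), and the per-plaquette schema on the wedge. -/

section Wedge

/-- Shifted tails of a summable profile are summable. [folklore] -/
private theorem summable_shift {q : ℕ → ℝ} (hq : Summable q) (n : ℕ) : Summable fun t => q (t + n) :=
  (summable_nat_add_iff n).mpr hq

/-- **AVERAGED HEIGHTS ON THE WEDGE SUFFICE FOR K2's BODY** (`0 < γ ≤ 1`, `0 < b₀`, `1 ≤ p₀`, `m ≥ 1`): a profile `q ≥ 0`, `Σ q < ∞`,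
`Σ_n Σ'_t q(t+n) < ∞` with `Gibbs_K{¬PlaqSmall θ(K−j) (Ū^{j})} ≤ q(K−j)` for the heights `1 ≤ j ≤ K` ON THE WEDGE `K ≤ m·(K − j + 1)` only
gives `HistoryTailAt F γ b₀ p₀ m`: the bare height is `bareTailAt`, the two profiles add, then `historyTailAt_of_heightTailOnWedge'`.
[cite: Balaban1985UV3, (7) p.257 and (71) p.273] -/
theorem historyTailAt_of_averagedTailOnWedge (F : T3Family) {γ b₀ p₀ : ℝ} (hγ : 0 < γ) (hγ1 : γ ≤ 1) (hb₀ : 0 < b₀)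
    (hp₀ : 1 ≤ p₀) {m : ℕ} (hm : 0 < m) (q : ℕ → ℝ) (hq0 : ∀ i, 0 ≤ q i) (hq : Summable q)
    (hqt : Summable fun n => ∑' t, q (t + n))
    (h : ∀ K j : ℕ, 1 ≤ j → j ≤ K → K ≤ m * (K - j + 1) →
      (gibbsK F ℰp γ K).real
          {U | ¬ PlaqSmall (θBal F.L γ b₀ p₀ (K - j))
            (Averaging.iter (fun i => BlockAveraging.blockAvg (P := F.P K) (j := i) ℰp) j U)} ≤ q (K - j)) :
    HistoryTailAt F γ b₀ p₀ m := by
  obtain ⟨q₁, hq₁0, hq₁, hq₁t, h₁⟩ := bareTailAt F hγ hγ1 hb₀ hp₀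
  refine T3HistoryTailReduction.historyTailAt_of_heightTailOnWedge' F hγ.le b₀ p₀ hm (fun i => q₁ i + q i)
    (fun i => add_nonneg (hq₁0 i) (hq0 i)) (hq₁.add hq) ?_ fun K j hjK hw => ?_
  · have heq : (fun n => ∑' t, (q₁ (t + n) + q (t + n))) = fun n => (∑' t, q₁ (t + n)) + ∑' t, q (t + n) := by
      funext n
      exact (summable_shift hq₁ n).tsum_add (summable_shift hq n)
    rw [heq]
    exact hq₁t.add hqt
  · rcases Nat.eq_zero_or_pos j with rfl | hjpos
    · have hK : (gibbsK F ℰp γ K).real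
          {U | ¬ PlaqSmall (θBal F.L γ b₀ p₀ (K - 0))
            (Averaging.iter (fun i => BlockAveraging.blockAvg (P := F.P K) (j := i) ℰp) 0 U)} ≤ q₁ (K - 0) := h₁ K
      exact hK.trans (le_add_of_nonneg_right (hq0 _))
    · exact (h K j hjpos hjK hw).trans (le_add_of_nonneg_left (hq₁0 _))

/-- **K2's BODY FROM THE PER-PLAQUETTE SCHEMA ON THE WEDGE** (`0 < γ ≤ 1`, `0 < b₀`, `1 ≤ p₀`, `m ≥ 1`): if for some `C ≥ 0`, `A : ℕ`, `c > 0`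
every block-averaged plaquette `p` of height `1 ≤ j ≤ K` ON THE WEDGE `K ≤ m·(K − j + 1)` of every approximation `K` has Gibbs tail
`Gibbs_K{θ(K−j) ≤ |Ū^{j}(∂p) − 1|} ≤ C·β_{K−j}^A·e^{−c·p(g_{K−j})²}`, then `HistoryTailAt F γ b₀ p₀ m` — the wedge twin of
`historyTailAt_of_perPlaquette` (union bound over the `≤ 9·(2L^{m+K−j})³` plaquettes of the height, `perHeight_bound`, geometric profile
`A'·2^{−i}`, `historyTailAt_of_averagedTailOnWedge`).  On the wedge every coupling in play is `g²_{K−j} = γL^{−(K−j)} ≤ γL·L^{−K/m}`.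
[cite: Balaban1985UV3, (7) p.257 and (71) p.273; King1986, (3.12) p.657] -/
theorem historyTailAt_of_perPlaquetteOnWedge (F : T3Family) {γ b₀ p₀ : ℝ} (hγ : 0 < γ) (hγ1 : γ ≤ 1) (hb₀ : 0 < b₀)
    (hp₀ : 1 ≤ p₀) {m : ℕ} (hm : 0 < m)
    (h : ∃ (C : ℝ) (A : ℕ) (c : ℝ), 0 ≤ C ∧ 0 < c ∧
      ∀ (K j : ℕ), 1 ≤ j → j ≤ K → K ≤ m * (K - j + 1) → ∀ p : Plaq (F.P K) j,
        (gibbsK F ℰp γ K).real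
            {U | θBal F.L γ b₀ p₀ (K - j) ≤
              GaugeGroup.dist1 (GaugeField.plaqHol
                (Averaging.iter (fun i => BlockAveraging.blockAvg (P := F.P K) (j := i) ℰp) j U) p)} ≤
          C * (F.scheme ℰp γ).β (K - j) ^ A *
            Real.exp (-(c * B10.pFun b₀ p₀ (Real.sqrt (γ * ((F.L : ℝ)⁻¹) ^ (K - j))) ^ 2))) :
    HistoryTailAt F γ b₀ p₀ m := by
  obtain ⟨C, A, c, hC, hc, hbound⟩ := h
  -- the explicit constant of `perHeight_bound`
  obtain ⟨A', hA'def⟩ : ∃ A' : ℝ, A' = 72 * C * (F.L : ℝ) ^ (3 * F.m) * γ⁻¹ ^ A *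
      Real.exp ((((3 : ℝ) + A) * Real.log F.L + Real.log 2) ^ 2 / (4 * (c * b₀ ^ 2 * Real.log F.L ^ 2 / 4))) := ⟨_, rfl⟩
  have hA'0 : 0 ≤ A' := by rw [hA'def]; positivity
  refine historyTailAt_of_averagedTailOnWedge F hγ hγ1 hb₀ hp₀ hm (fun i => A' * (1 / 2 : ℝ) ^ i) (fun i => by positivity)
    ((summable_geometric_of_lt_one (by norm_num) (by norm_num)).mul_left A') ?_ fun K j hj1 hjK hw => ?_
  · have heq : (fun n => ∑' t, A' * (1 / 2 : ℝ) ^ (t + n)) = fun n => (2 * A') * (1 / 2 : ℝ) ^ n := by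
      funext n
      have h1 : (fun t => A' * (1 / 2 : ℝ) ^ (t + n)) = fun t => (A' * (1 / 2 : ℝ) ^ n) * (1 / 2 : ℝ) ^ t := by
        funext t; rw [pow_add]; ring
      rw [h1, tsum_mul_left, tsum_geometric_two]; ring
    rw [heq]
    exact (summable_geometric_of_lt_one (by norm_num) (by norm_num)).mul_left (2 * A')
  · -- the union bound over the plaquettes of height `j`, pulled back along the `j`-fold averaging (as in `averagedTailAt_of_perPlaquette`)
    haveI := isProbabilityMeasure_gibbsK F ℰp hγ.le K
    have hunion := real_not_plaqSmall_comp_le_sum (gibbsK F ℰp γ K)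
      (fun U => Averaging.iter (fun i => BlockAveraging.blockAvg (P := F.P K) (j := i) ℰp) j U) (θBal F.L γ b₀ p₀ (K - j))
    refine hunion.trans ?_
    refine (Finset.sum_le_sum fun p _ => hbound K j hj1 hjK hw p).trans ?_
    rw [Finset.sum_const, Finset.card_univ, nsmul_eq_mul]
    have hM : ((F.P K).sitesPerDir j : ℝ) ^ 3 = 8 * (F.L : ℝ) ^ (3 * F.m) * ((F.L : ℝ) ^ (K - j)) ^ 3 := by
      rw [sitesPerDir_eq F hjK]; push_cast; ring
    have hcard : (Fintype.card (Plaq (F.P K) j) : ℝ) ≤ 9 * (8 * (F.L : ℝ) ^ (3 * F.m) * ((F.L : ℝ) ^ (K - j)) ^ 3) := by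
      rw [← hM]; exact card_plaq_le F K j
    have hnonneg : 0 ≤ C * (F.scheme ℰp γ).β (K - j) ^ A *
        Real.exp (-(c * B10.pFun b₀ p₀ (Real.sqrt (γ * ((F.L : ℝ)⁻¹) ^ (K - j))) ^ 2)) :=
      mul_nonneg (mul_nonneg hC (pow_nonneg (F.scheme_β_nonneg ℰp hγ.le (K - j)) A)) (Real.exp_nonneg _)
    refine (mul_le_mul_of_nonneg_right hcard hnonneg).trans ?_
    rw [hA'def]
    exact perHeight_bound F hγ hγ1 hb₀ hp₀ hC A hc (K - j)

/-- The unrestricted schema implies the wedge-restricted one (the guard is dropped), so `historyTailAt_of_perPlaquette` is recovered from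
`historyTailAt_of_perPlaquetteOnWedge` — recorded so that consumers may cite either shape. [cite: Balaban1985UV3, (71) p.273] -/
theorem historyTailAt_of_perPlaquette_of_onWedge (F : T3Family) {γ b₀ p₀ : ℝ} (hγ : 0 < γ) (hγ1 : γ ≤ 1) (hb₀ : 0 < b₀)
    (hp₀ : 1 ≤ p₀) {m : ℕ} (hm : 0 < m)
    (h : ∃ (C : ℝ) (A : ℕ) (c : ℝ), 0 ≤ C ∧ 0 < c ∧
      ∀ (K j : ℕ), 1 ≤ j → j ≤ K → ∀ p : Plaq (F.P K) j,
        (gibbsK F ℰp γ K).real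
            {U | θBal F.L γ b₀ p₀ (K - j) ≤
              GaugeGroup.dist1 (GaugeField.plaqHol
                (Averaging.iter (fun i => BlockAveraging.blockAvg (P := F.P K) (j := i) ℰp) j U) p)} ≤
          C * (F.scheme ℰp γ).β (K - j) ^ A *
            Real.exp (-(c * B10.pFun b₀ p₀ (Real.sqrt (γ * ((F.L : ℝ)⁻¹) ^ (K - j))) ^ 2))) :
    HistoryTailAt F γ b₀ p₀ m := by
  obtain ⟨C, A, c, hC, hc, hbound⟩ := h
  exact historyTailAt_of_perPlaquetteOnWedge F hγ hγ1 hb₀ hp₀ hm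
    ⟨C, A, c, hC, hc, fun K j hj1 hjK _ p => hbound K j hj1 hjK p⟩

end Wedge

end Literature.MathematicalPhysics.QuantumFieldTheory.Balaban1983to89.T3AveragedTailProfile

end
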